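import Literature.AlgebraicGeometry.Modules.CechProductCoverLexSystem
import Literature.AlgebraicGeometry.Modules.CechPullbackSystemHom
import HarnessLib

/-!
# The Čech complex of the product cover with coefficients `𝒪`: `Č(lexSystem (Γ(𝓤,𝒪_X) ⊠ Γ(𝓥,𝒪_Y))) ≅ Č(W₀, 𝒪_{X ×_S Y})`
# (The Stacks Project, Tag 0BEC; Görtz–Wedhorn I, Prop. 4.16 ∕ (4.8): `Γ(U ×_S V, 𝒪) = Γ(U, 𝒪_X) ⊗_{Γ(S)} Γ(V, 𝒪_Y)`)

Layer `Literature/AlgebraicGeometry/Modules`, namespace `Literature.AlgebraicGeometry.Modules`.  THEOREMS ONLY (no definition, no named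
fact, no instance, no notation, no `sorry`).  Cell `hodgecm-mathlib` (D-0151), F-11 ∕ J3 Künneth packet, (G3)∕(iv-4) BRIDGE piece (B-i′) — the
`𝒪`-SPECIALISATION of ★ `Modules/CechProductCoverLexSystemTensor` (which lands in `Č(W₀, 𝒪_X ⊠ 𝒪_Y)`): here the target is the Čech complex of
the product cover with coefficients in the STRUCTURE SHEAF `𝒪_Z` of `Z = X ×_S Y` itself — the complex `CS = cechComplex W₀ (unitModule (X × X)) ρ₂`
of F0P1b-p02 (g2)'s F-J3b skeleton on which the cup product and the pull-backs `p₁^*`, `p₂^*` are read (B-p06 (g15); consumers: the (G3) assembly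
`stub_hinj`∕`stub_hsurj` of that skeleton, B-p21 (g21)'s `Algebra/Homology/KunnethComponentsBookkeeping`).

For a cartesian square `H : IsPullback p q iX iY` (`Z = X ×_S Y`, `p`, `q` the projections) over an AFFINE base `S` with `φ : A ≃+* Γ(S, ⊤)`,
structure maps `ρX = iX♯ ∘ φ`, `ρY = iY♯ ∘ φ`, `ρZ = p♯ ∘ ρX` (hypotheses `hρX`, `hρY`, `hρZ`, pointwise — the shape of the F-J3b binders
`hρ_p₁ : ρ₂ a = p₁.appTop (ρ₁ a)`), affine `U ⊆ X`, `V ⊆ Y` and `W = p⁻¹U ∩ q⁻¹V`: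
* §1 **`exists_secModTensorEquiv_unit`** — an `A`-linear isomorphism `Γ(U, 𝒪_X) ⊗_A Γ(V, 𝒪_Y) ≃ Γ(W, 𝒪_Z)` in the `SecMod` dialect of
  ★ `Modules/ModuleCechComplex` ∕ `CechUnitModulePairing`, CHARACTERISED on pure tensors: `a ⊗ b ↦ p♯(a)|_W · q♯(b)|_W`.  Proof: the ring square
  `Γ(S) → Γ(U), Γ(V) → Γ(W)` is a pushout (★ `Modules/PullbackSectionsBaseChange.isPushout_sections_of_isPullback`, i.e. Mathlib's
  `isIso_pushoutSection_of_isAffineOpen`, Görtz–Wedhorn I Prop. 4.16), so Mathlib's `Algebra.IsPushout.equiv : Γ(U) ⊗_{Γ(S)} Γ(V) ≃ₐ Γ(W)`,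
  `a ⊗ b ↦ p♯a · q♯b`; the `A`-bilinear candidate `SecMod ⊗_A SecMod → SecMod` is compared with it through `φ`.
* §2 **`exists_sysComplex_lexSystem_prodSystem_iso_cechComplex_unit`** — for covers `𝓤`, `𝓥` with affine non-empty finite intersections, an
  isomorphism of cochain complexes `Č(lexSystem (sectionsSystem 𝓤 𝒪_X ρX ⊠ sectionsSystem 𝓥 𝒪_Y ρY)) ≅ cechComplex W₀ 𝒪_Z ρZ`,
  `W₀ (i,j) = p⁻¹U_i ∩ q⁻¹V_j`, TOGETHER WITH its simplexwise components `ε_T : Γ(𝓤_{π₁T}) ⊗_A Γ(𝓥_{π₂T}) ≃ Γ(W₀_T, 𝒪_Z)` and their formula on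
  pure tensors (`(e g)_T = ε_T (g_T)`, `ε_T (a ⊗ b) = p♯(a)|_{W₀,T} · q♯(b)|_{W₀,T}`) — §1 on every simplex (★ `cechOpen_prodCover_eq`:
  `W₀_T = p⁻¹𝓤_{π₁T} ∩ q⁻¹𝓥_{π₂T}`), assembled by ★ `OrderedCech.sysComplexIsoNE`; naturality = `p♯`, `q♯` commute with restrictions.
With ★ `Algebra/Homology/OrderedCechPairSystemKunneth.bijective_homologyMap_tensor_cross` (F-K3) this puts the Künneth comparison
`Hⁿ(Č(𝓤,𝒪_X) ⊗ Č(𝓥,𝒪_Y)) → Hⁿ(Č(W₀, 𝒪_Z))` on p02's complex `CS`; the identification of the composite with `y ⊗ z ↦ p₁^*y ∪ p₂^*z` is piece (B-ii).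

HC_CM is proved only modulo the 7 printed citations until rung 0 closes — nothing here bears on a summit statement.

## References
* [StacksProject] The Stacks Project, Tag 0BEC (Künneth: the Čech complex of the product cover `𝓤 × 𝓥` of `X ×_S Y` over an affine base),
  Tag 01JO (fibre products of affine schemes), Tag 01FG (Čech complexes, refinements).
* [GortzWedhorn2020] U. Görtz, T. Wedhorn, *Algebraic Geometry I*, 2nd ed. (2020), Prop. 4.16 and (4.8) (pp. 101–104) (`Spec A ×_{Spec R} Spec B =
  Spec (A ⊗_R B)`), Rem. 7.25.
* [GortzWedhorn2023] U. Görtz, T. Wedhorn, *Algebraic Geometry II* (2023), Def. 21.68 (p. 180) (module Čech complex of a cover).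
-/

set_option backward.isDefEq.respectTransparency false -- `Scheme.Modules` is not reducible (as in ★ `CechBoxTensorBicomplex`)

noncomputable section

universe u

open CategoryTheory AlgebraicGeometry TopologicalSpace TensorProduct MonoidalCategory Opposite
open Literature.Algebra.Homology Literature.Algebra.Homology.OrderedCech

namespace Literature.AlgebraicGeometry.Modules

variable {X Y Z S : Scheme.{u}} {p : Z ⟶ X} {q : Z ⟶ Y} {iX : X ⟶ S} {iY : Y ⟶ S} {A : Type u} [CommRing A]
  [IsAffine S] (H : IsPullback p q iX iY) (φ : A ≃+* Γ(S, ⊤))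
  {ρX : A →+* Γ(X, ⊤)} {ρY : A →+* Γ(Y, ⊤)} {ρZ : A →+* Γ(Z, ⊤)}
  (hρX : ∀ c, ρX c = iX.appTop (φ c)) (hρY : ∀ c, ρY c = iY.appTop (φ c)) (hρZ : ∀ c, ρZ c = p.appTop (ρX c))

/-! ## §0 Scalars -/

omit [IsAffine S] in
/-- `U ⊆ f⁻¹(⊤)`. [folklore] [cite: GortzWedhorn2020, Prop. 4.16 (pp. 101–104)] -/
theorem le_preimage_top' (f : X ⟶ S) (U : X.Opens) : U ≤ f ⁻¹ᵁ ⊤ := le_top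

omit [IsAffine S] in
include H hρX hρY hρZ in
/-- The structure map of `Z` also factors through `q`: `ρZ = q♯ ∘ ρY` (`p ≫ iX = q ≫ iY`). [cite: GortzWedhorn2020, Prop. 4.16 (pp. 101–104)] -/
theorem ρZ_eq_appTop_snd (c : A) : ρZ c = q.appTop (ρY c) := by
  rw [hρZ, hρX, hρY]
  change (iX.appTop ≫ p.appTop) (φ c) = (iY.appTop ≫ q.appTop) (φ c)
  rw [← Scheme.Hom.comp_appTop, ← Scheme.Hom.comp_appTop, H.w]

omit [IsAffine S] in
include hρX in
/-- The structure constants of `X` restricted to `U` are the images of those of `S`: `ρX(c)|_U = iX♯_{⊤,U}(φ c)`.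
[cite: GortzWedhorn2020, Prop. 4.16 (pp. 101–104)] -/
theorem toSections_eq_appLE (U : X.Opens) (c : A) : toSections ρX U c = iX.appLE ⊤ U (le_preimage_top' iX U) (φ c) := by
  change (X.presheaf.map (homOfLE le_top).op) (ρX c) = _
  rw [hρX]
  change (iX.appTop ≫ X.presheaf.map (homOfLE le_top).op) (φ c) = _
  rw [Scheme.Hom.appTop, Scheme.Hom.app_eq_appLE, Scheme.Hom.appLE_map]

/-! ## §1 `Γ(U, 𝒪_X) ⊗_A Γ(V, 𝒪_Y) ≃ Γ(U ×_S V, 𝒪_Z)`, `a ⊗ b ↦ p♯a · q♯b` -/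

section Affine

variable {U : X.Opens} {V : Y.Opens} {W : Z.Opens}

include H hρX hρY hρZ in
/-- **Affine Künneth in degree `0` for the structure sheaf, characterised**: for a cartesian square `Z = X ×_S Y` over an affine base with
`φ : A ≃ Γ(S, ⊤)`, structure maps `ρX = iX♯φ`, `ρY = iY♯φ`, `ρZ = p♯ρX`, affine `U ⊆ X`, `V ⊆ Y` and `W = p⁻¹U ∩ q⁻¹V`, there is an
`A`-linear isomorphism `Γ(U, 𝒪_X) ⊗_A Γ(V, 𝒪_Y) ≃ Γ(W, 𝒪_Z)` (sections as `A`-modules through `ρ`, ★ `SecMod`) sending `a ⊗ b` to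
`p♯(a)|_W · q♯(b)|_W` (`Γ(W) = Γ(U) ⊗_{Γ(S)} Γ(V)`, Görtz–Wedhorn I Prop. 4.16; Mathlib `isIso_pushoutSection_of_isAffineOpen` through ★
`isPushout_sections_of_isPullback` and `Algebra.IsPushout.equiv`). [cite: GortzWedhorn2020, Prop. 4.16 and (4.8) (pp. 101–104)]
[cite: StacksProject, Tag 01JO] -/
theorem exists_secModTensorEquiv_unit (hU : IsAffineOpen U) (hV : IsAffineOpen V) (hW : W = p ⁻¹ᵁ U ⊓ q ⁻¹ᵁ V) :
    ∃ e : SecMod (unitModule X) ρX U ⊗[A] SecMod (unitModule Y) ρY V ≃ₗ[A] SecMod (unitModule Z) ρZ W,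
      ∀ (a : SecMod (unitModule X) ρX U) (b : SecMod (unitModule Y) ρY V),
        SecMod.toRing ρZ (e (a ⊗ₜ b)) =
          p.appLE U W (le_preimage_left_of_eq_inf hW) (SecMod.toRing ρX a) *
            q.appLE V W (le_preimage_right_of_eq_inf hW) (SecMod.toRing ρY b) := by
  have hWU := le_preimage_left_of_eq_inf hW
  have hWV := le_preimage_right_of_eq_inf hW
  have hρZ' : ∀ c, ρZ c = q.appTop (ρY c) := ρZ_eq_appTop_snd H φ hρX hρY hρZ
  -- the four ring maps of the square of sections
  let fX : Γ(S, ⊤) →+* Γ(X, U) := (iX.appLE ⊤ U (le_preimage_top' iX U)).hom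
  let fY : Γ(S, ⊤) →+* Γ(Y, V) := (iY.appLE ⊤ V (le_preimage_top' iY V)).hom
  let gp : Γ(X, U) →+* Γ(Z, W) := (p.appLE U W hWU).hom
  let gq : Γ(Y, V) →+* Γ(Z, W) := (q.appLE V W hWV).hom
  have hgp : ∀ c, gp (toSections ρX U c) = toSections ρZ W c := fun c => appLE_toSections p ρX ρZ hρZ hWU c
  have hgq : ∀ c, gq (toSections ρY V c) = toSections ρZ W c := fun c => appLE_toSections q ρY ρZ hρZ' hWV c
  have hfX : ∀ c, fX (φ c) = toSections ρX U c := fun c => (toSections_eq_appLE φ hρX U c).symm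
  have hfY : ∀ c, fY (φ c) = toSections ρY V c := fun c => (toSections_eq_appLE φ hρY V c).symm
  -- the `A`-bilinear candidate
  let β : SecMod (unitModule X) ρX U →ₗ[A] SecMod (unitModule Y) ρY V →ₗ[A] SecMod (unitModule Z) ρZ W :=
    LinearMap.mk₂ A (fun a b => SecMod.ofRing ρZ (gp (SecMod.toRing ρX a) * gq (SecMod.toRing ρY b)))
      (fun a a' b => SecMod.toRing_injective ρZ (by
        rw [SecMod.toRing_ofRing, SecMod.toRing_add, SecMod.toRing_add, SecMod.toRing_ofRing, SecMod.toRing_ofRing, map_add,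
          add_mul]))
      (fun c a b => SecMod.toRing_injective ρZ (by
        rw [SecMod.toRing_ofRing, SecMod.toRing_smul, SecMod.toRing_smul, SecMod.toRing_ofRing, map_mul, hgp, mul_assoc]))
      (fun a b b' => SecMod.toRing_injective ρZ (by
        rw [SecMod.toRing_ofRing, SecMod.toRing_add, SecMod.toRing_add, SecMod.toRing_ofRing, SecMod.toRing_ofRing, map_add,
          mul_add]))
      (fun c a b => SecMod.toRing_injective ρZ (by
        rw [SecMod.toRing_ofRing, SecMod.toRing_smul, SecMod.toRing_smul, SecMod.toRing_ofRing, map_mul, hgq, mul_left_comm]))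
  let f : SecMod (unitModule X) ρX U ⊗[A] SecMod (unitModule Y) ρY V →ₗ[A] SecMod (unitModule Z) ρZ W :=
    TensorProduct.lift β
  have hf : ∀ a b, SecMod.toRing ρZ (f (a ⊗ₜ b)) = gp (SecMod.toRing ρX a) * gq (SecMod.toRing ρY b) := fun a b => by
    simp only [f, TensorProduct.lift.tmul]; rfl
  -- the ring square of sections is a pushout: `Γ(W) = Γ(U) ⊗_{Γ(S)} Γ(V)`
  letI : Algebra Γ(S, ⊤) Γ(X, U) := fX.toAlgebra
  letI : Algebra Γ(S, ⊤) Γ(Y, V) := fY.toAlgebra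
  letI : Algebra Γ(X, U) Γ(Z, W) := gp.toAlgebra
  letI : Algebra Γ(Y, V) Γ(Z, W) := gq.toAlgebra
  letI : Algebra Γ(S, ⊤) Γ(Z, W) := (gp.comp fX).toAlgebra
  haveI : IsScalarTower Γ(S, ⊤) Γ(X, U) Γ(Z, W) := IsScalarTower.of_algebraMap_eq fun r => rfl
  haveI : IsScalarTower Γ(S, ⊤) Γ(Y, V) Γ(Z, W) :=
    IsScalarTower.of_algebraMap_eq fun r => appLE_appLE_eq_of_comm_sq H.w (le_preimage_top' iY V) (le_preimage_top' iX U) hW r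
  have hpo : Algebra.IsPushout Γ(S, ⊤) Γ(Y, V) Γ(X, U) Γ(Z, W) :=
    isPushout_sections_of_isPullback H (isAffineOpen_top S) hV hU (le_preimage_top' iY V) (le_preimage_top' iX U) hW
      rfl rfl rfl rfl
  haveI : Algebra.IsPushout Γ(S, ⊤) Γ(X, U) Γ(Y, V) Γ(Z, W) := hpo.symm
  let ε : Γ(X, U) ⊗[Γ(S, ⊤)] Γ(Y, V) ≃ₐ[Γ(X, U)] Γ(Z, W) := Algebra.IsPushout.equiv Γ(S, ⊤) Γ(X, U) Γ(Y, V) Γ(Z, W)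
  have hε : ∀ a b, ε (a ⊗ₜ b) = gp a * gq b := fun a b => Algebra.IsPushout.equiv_tmul Γ(S, ⊤) Γ(X, U) Γ(Y, V) Γ(Z, W) a b
  -- the comparison `Γ(U) ⊗_{Γ(S)} Γ(V) → SecMod U ⊗_A SecMod V` (a balanced biadditive map: scalars of `Γ(S)` act through `φ⁻¹`)
  have hX : ∀ (r : Γ(S, ⊤)) (a : Γ(X, U)), SecMod.ofRing ρX (fX r * a) = φ.symm r • SecMod.ofRing ρX a := fun r a =>
    SecMod.toRing_injective ρX (by
      rw [SecMod.toRing_ofRing, SecMod.toRing_smul, SecMod.toRing_ofRing, ← hfX, RingEquiv.apply_symm_apply])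
  have hY : ∀ (r : Γ(S, ⊤)) (b : Γ(Y, V)), SecMod.ofRing ρY (fY r * b) = φ.symm r • SecMod.ofRing ρY b := fun r b =>
    SecMod.toRing_injective ρY (by
      rw [SecMod.toRing_ofRing, SecMod.toRing_smul, SecMod.toRing_ofRing, ← hfY, RingEquiv.apply_symm_apply])
  let γ : Γ(X, U) →+ Γ(Y, V) →+ SecMod (unitModule X) ρX U ⊗[A] SecMod (unitModule Y) ρY V :=
    { toFun := fun a =>
        { toFun := fun b => SecMod.ofRing ρX a ⊗ₜ SecMod.ofRing ρY b
          map_zero' := TensorProduct.tmul_zero _ _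
          map_add' := fun b b' => TensorProduct.tmul_add _ _ _ }
      map_zero' := AddMonoidHom.ext fun b => TensorProduct.zero_tmul _ _
      map_add' := fun a a' => AddMonoidHom.ext fun b => TensorProduct.add_tmul _ _ _ }
  have hγ : ∀ (r : Γ(S, ⊤)) (a : Γ(X, U)) (b : Γ(Y, V)), γ (r • a) b = γ a (r • b) := fun r a b => by
    change SecMod.ofRing ρX (fX r * a) ⊗ₜ[A] SecMod.ofRing ρY b = SecMod.ofRing ρX a ⊗ₜ[A] SecMod.ofRing ρY (fY r * b)
    rw [hX, hY, TensorProduct.smul_tmul]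
  let g : Γ(X, U) ⊗[Γ(S, ⊤)] Γ(Y, V) →+ SecMod (unitModule X) ρX U ⊗[A] SecMod (unitModule Y) ρY V :=
    TensorProduct.liftAddHom γ hγ
  have hg : ∀ a b, g (a ⊗ₜ b) = SecMod.ofRing ρX a ⊗ₜ SecMod.ofRing ρY b := fun a b => TensorProduct.liftAddHom_tmul γ hγ a b
  -- `g ∘ ε⁻¹ ∘ f = id`: `f` is injective
  have hleft : ∀ x, g (ε.symm (SecMod.toRing ρZ (f x))) = x := fun x => by
    induction x using TensorProduct.induction_on with
    | zero => simp only [map_zero, SecMod.toRing_zero]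
    | add x y hx hy => rw [map_add, SecMod.toRing_add, map_add, map_add, hx, hy]
    | tmul a b =>
      rw [hf, ← hε, AlgEquiv.symm_apply_apply, hg]
      rfl
  -- `f` is onto: `ε` is, and `f (g (a ⊗ b)) = ε (a ⊗ b)` on pure tensors
  have hright : ∀ y, SecMod.toRing ρZ (f (g y)) = ε y := fun y => by
    induction y using TensorProduct.induction_on with
    | zero => simp only [map_zero, SecMod.toRing_zero]
    | add x y hx hy => rw [map_add, map_add, SecMod.toRing_add, map_add, hx, hy]
    | tmul a b => rw [hg, hf, hε]; rfl
  have hbij : Function.Bijective f := by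
    refine ⟨fun x y hxy => by rw [← hleft x, ← hleft y, hxy], fun z => ⟨g (ε.symm (SecMod.toRing ρZ z)), ?_⟩⟩
    apply SecMod.toRing_injective ρZ
    rw [hright, AlgEquiv.apply_symm_apply]
  exact ⟨LinearEquiv.ofBijective f hbij, fun a b => by rw [LinearEquiv.ofBijective_apply]; exact hf a b⟩

end Affine

/-! ## §2 The Čech complex of the product cover with coefficients `𝒪_Z` -/

section Cech

variable {ι κ : Type} [LinearOrder ι] [LinearOrder κ] (𝓤 : ι → X.Opens) (𝓥 : κ → Y.Opens)
  (hU : ∀ s : Finset ι, s.Nonempty → IsAffineOpen (cechOpen 𝓤 s)) (hV : ∀ t : Finset κ, t.Nonempty → IsAffineOpen (cechOpen 𝓥 t))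

include H hρX hρY hρZ hU hV in
/-- **`Č(lexSystem (Γ(𝓤, 𝒪_X) ⊠ Γ(𝓥, 𝒪_Y))) ≅ Č(W₀, 𝒪_Z)`, CHARACTERISED** (`W₀ (i,j) = p⁻¹U_i ∩ q⁻¹V_j`, affine base, affine non-empty
finite intersections): the lexicographic system of the tensored Čech systems of `𝒪_X` on `𝓤` and `𝒪_Y` on `𝓥` has the SAME ordered Čech complex as
the product cover of `Z = X ×_S Y` with coefficients `𝒪_Z`; the isomorphism `e` comes with its simplexwise components `ε_T` (§1 over
`(𝓤_{π₁T}, 𝓥_{π₂T})`, then restriction along ★ `cechOpen_prodCover_eq`) and their formula on pure tensors `ε_T (a ⊗ b) = p♯(a)|_{W₀,T} · q♯(b)|_{W₀,T}`.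
[cite: StacksProject, Tag 0BEC] [cite: GortzWedhorn2020, Prop. 4.16 and (4.8) (pp. 101–104)] [cite: GortzWedhorn2023, Def. 21.68 (p. 180)] -/
theorem exists_sysComplex_lexSystem_prodSystem_iso_cechComplex_unit :
    ∃ (e : sysComplex (lexSystem (prodSystem (sectionsSystem 𝓤 (unitModule X) ρX) (sectionsSystem 𝓥 (unitModule Y) ρY))) ≅
        cechComplex (fun c : ι ×ₗ κ => p ⁻¹ᵁ 𝓤 (ofLex c).1 ⊓ q ⁻¹ᵁ 𝓥 (ofLex c).2) (unitModule Z) ρZ)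
      (ε : ∀ T : Finset (ι ×ₗ κ), T.Nonempty →
        (SecMod (unitModule X) ρX (cechOpen 𝓤 (fstProj T)) ⊗[A] SecMod (unitModule Y) ρY (cechOpen 𝓥 (sndProj T)) ≃ₗ[A]
          SecMod (unitModule Z) ρZ (cechOpen (fun c : ι ×ₗ κ => p ⁻¹ᵁ 𝓤 (ofLex c).1 ⊓ q ⁻¹ᵁ 𝓥 (ofLex c).2) T))),
      (∀ (n : ℤ) (g : SysCochain (lexSystem (prodSystem (sectionsSystem 𝓤 (unitModule X) ρX)
          (sectionsSystem 𝓥 (unitModule Y) ρY))) n) (σ : Simplex (ι ×ₗ κ) n), ((e.hom.f n).hom g) σ = ε σ.1 σ.2.1 (g σ)) ∧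
      ∀ (T : Finset (ι ×ₗ κ)) (hT : T.Nonempty) (a : SecMod (unitModule X) ρX (cechOpen 𝓤 (fstProj T)))
        (b : SecMod (unitModule Y) ρY (cechOpen 𝓥 (sndProj T))),
        SecMod.toRing ρZ (ε T hT (a ⊗ₜ b)) =
          p.appLE (cechOpen 𝓤 (fstProj T)) _ (le_preimage_left_of_eq_inf (cechOpen_prodCover_eq p q 𝓤 𝓥 T)) (SecMod.toRing ρX a) *
            q.appLE (cechOpen 𝓥 (sndProj T)) _ (le_preimage_right_of_eq_inf (cechOpen_prodCover_eq p q 𝓤 𝓥 T))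
              (SecMod.toRing ρY b) := by
  -- §1 on every pair of non-empty finite sets of indices
  have h1 : ∀ (s : Finset ι) (t : Finset κ), s.Nonempty → t.Nonempty →
      ∃ e : SecMod (unitModule X) ρX (cechOpen 𝓤 s) ⊗[A] SecMod (unitModule Y) ρY (cechOpen 𝓥 t) ≃ₗ[A]
          SecMod (unitModule Z) ρZ (p ⁻¹ᵁ cechOpen 𝓤 s ⊓ q ⁻¹ᵁ cechOpen 𝓥 t),
        ∀ a b, SecMod.toRing ρZ (e (a ⊗ₜ b)) =
          p.appLE (cechOpen 𝓤 s) _ (le_preimage_left_of_eq_inf rfl) (SecMod.toRing ρX a) *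
            q.appLE (cechOpen 𝓥 t) _ (le_preimage_right_of_eq_inf rfl) (SecMod.toRing ρY b) :=
    fun s t hs ht => exists_secModTensorEquiv_unit H φ hρX hρY hρZ (hU s hs) (hV t ht) rfl
  choose e₀ he₀ using h1
  -- the characterised iso `lexSystem (boxSectionsSystem …) ≅ sectionsSystem W₀ …` of ★ `CechProductCoverLexSystem`
  obtain ⟨e₂, he₂, -⟩ := exists_lexSystem_boxSectionsSystem_iso_sectionsSystem p q 𝓤 𝓥 (unitModule Z) ρZ
  -- componentwise isos on NON-EMPTY chains
  let e₁ : ∀ T : Finset (ι ×ₗ κ), T.Nonempty →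
      ((lexSystem (prodSystem (sectionsSystem 𝓤 (unitModule X) ρX) (sectionsSystem 𝓥 (unitModule Y) ρY))).obj T ≃ₗ[A]
        (sectionsSystem (fun c : ι ×ₗ κ => p ⁻¹ᵁ 𝓤 (ofLex c).1 ⊓ q ⁻¹ᵁ 𝓥 (ofLex c).2) (unitModule Z) ρZ).obj T) := fun T hT =>
    (e₀ _ _ (fstProj_nonempty_iff.2 hT) (sndProj_nonempty_iff.2 hT)).trans (e₂.app T).toLinearEquiv
  have he₁f : ∀ (T : Finset (ι ×ₗ κ)) (hT : T.Nonempty) (a : SecMod (unitModule X) ρX (cechOpen 𝓤 (fstProj T)))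
      (b : SecMod (unitModule Y) ρY (cechOpen 𝓥 (sndProj T))),
      SecMod.toRing ρZ (e₁ T hT (a ⊗ₜ b)) =
        p.appLE (cechOpen 𝓤 (fstProj T)) _ (le_preimage_left_of_eq_inf (cechOpen_prodCover_eq p q 𝓤 𝓥 T)) (SecMod.toRing ρX a) *
          q.appLE (cechOpen 𝓥 (sndProj T)) _ (le_preimage_right_of_eq_inf (cechOpen_prodCover_eq p q 𝓤 𝓥 T))
            (SecMod.toRing ρY b) := by
    intro T hT a b
    change SecMod.toRing ρZ ((e₂.hom.app T).hom (e₀ _ _ _ _ (a ⊗ₜ b))) = _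
    rw [he₂, SecMod.toRing_res, he₀, map_mul]
    change (p.appLE _ _ _ ≫ Z.presheaf.map (homOfLE _).op) _ * (q.appLE _ _ _ ≫ Z.presheaf.map (homOfLE _).op) _ = _
    rw [Scheme.Hom.appLE_map, Scheme.Hom.appLE_map]
  have he₁ : ∀ (T T' : Finset (ι ×ₗ κ)) (hT : T.Nonempty) (hT' : T'.Nonempty) (h : T ⊆ T')
      (x : (lexSystem (prodSystem (sectionsSystem 𝓤 (unitModule X) ρX) (sectionsSystem 𝓥 (unitModule Y) ρY))).obj T),
      e₁ T' hT' (((lexSystem (prodSystem (sectionsSystem 𝓤 (unitModule X) ρX) (sectionsSystem 𝓥 (unitModule Y) ρY))).map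
          (homOfLE h)).hom x) =
        ((sectionsSystem (fun c : ι ×ₗ κ => p ⁻¹ᵁ 𝓤 (ofLex c).1 ⊓ q ⁻¹ᵁ 𝓥 (ofLex c).2) (unitModule Z) ρZ).map (homOfLE h)).hom
          (e₁ T hT x) := by
    intro T T' hT hT' h x
    induction x using TensorProduct.induction_on with
    | zero => simp only [map_zero]
    | add x y hx hy => simp only [map_add, hx, hy]
    | tmul a b =>
      rw [lexSystem_prodSystem_map_tmul, sectionsSystem_map_apply, sectionsSystem_map_apply, sectionsSystem_map_apply]
      apply SecMod.toRing_injective ρZ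
      rw [he₁f T' hT', SecMod.toRing_res, SecMod.toRing_res, SecMod.toRing_res, he₁f T hT, map_mul]
      change (X.presheaf.map (homOfLE _).op ≫ p.appLE _ _ _) _ * (Y.presheaf.map (homOfLE _).op ≫ q.appLE _ _ _) _ =
        (p.appLE _ _ _ ≫ Z.presheaf.map (homOfLE _).op) _ * (q.appLE _ _ _ ≫ Z.presheaf.map (homOfLE _).op) _
      rw [Scheme.Hom.map_appLE, Scheme.Hom.map_appLE, Scheme.Hom.appLE_map, Scheme.Hom.appLE_map]
  exact ⟨sysComplexIsoNE e₁ he₁, e₁, fun n g σ => sysComplexIsoNE_hom_f_apply e₁ he₁ n g σ, he₁f⟩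

end Cech

end Literature.AlgebraicGeometry.Modules

end
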